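import Summits.BirchSwinnertonDyer.Rank1Residual.AdditivePotMult.QuadraticBaseChangeModifiedTamagawaPotMult
import Summits.BirchSwinnertonDyer.Rank1Residual.AdditivePotMult.ModelFree
import Literature.NumberTheory.DiophantineGeometry.KodairaSymbolUnramifiedBaseChangeProofs
import HarnessLib

/-!
# The θ-model `⟨θ,0,0,0⟩ • W_K` (`θ² = d_K`): Miller's over-`K` input on it EQUALS the model-free
# input on the canonical model, and its odd Tamagawa identity (row T-MIL-UNI, FILE U-1b; seat
# n1011-p01 GEN 10)

HONEST FRAMING (cell `b2b-bsdres`, run/shared/lean/b2b/bsd-rank1-residual/, verbatim in every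
file): the goal of the cell is to DELETE the COMBINATION-SHAPED residual classes of the
Birch–Swinnerton-Dyer formula for ALL analytic-rank `≤ 1` elliptic curves over `ℚ` — "full BSD
formula for every rank `≤ 1` curve in class `C`" assembled STRICTLY from published theorems — so
that the rank-`≤ 1` remainder becomes exactly the CONSTRUCTION-SHAPED classes, which are TYPED
(missing-input `Prop`s), NOT attempted. This is not "finishing BSD". Sub-classes X3♯(M) / X4(M)
(additive, potentially multiplicative prime; base-change-and-descend): a RESEARCH ROUTE; they stay
CONSTRUCTION-SHAPED; nothing is booked by this file; no mark / label moved. THEOREMS ONLY: no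
definition, no named fact, no `sorry`.

## What (row T-MIL-UNI, `cells/n1011/skel/T-MIL-UNI.md` §0 (b)–(c))

For `θ ∈ K` with `θ² = d_K` and ANY `C' ∈ VariableChange K` (in the route `C' = ⟨θ, 0, 0, 0⟩`),
`C' • W_K` is a `K`-model of `E_K` — minimal at no place in general, which is irrelevant: FILE J-2's
`milneQuotient_ordp_of_tamagawa_anyRank` and FILE D-2's `bsdp_of_pPartOver_of_bsdp_twist_ordp` are
stated for ANY `K`-model.

* §1 `shaAnOver_smul_baseChange_eq_mul_shaAnOverC` — `shaAnOver (C' • W_K) = ρ · shaAnOverC (W ⊗ K)`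
  with `ρ = C(W⊗K)/(|N_{K/ℚ}(C'.u)| · ∏_w c_w) ∈ ℚ_{>0}`: leading coefficient, torsion, regulator and
  Tamagawa numbers are model invariants, the period scales by `|N(C'.u)|` (`bsdPeriod_smul'`);
  `missingPPartOverAt_smul_iff_overC_of_padicValRat_eq` — the two typed inputs agree as soon as
  `v_p ρ = 0`; `padicValRat_modifiedTamagawaProduct_baseChange_eq_norm_theta_mul`, `…_div_norm_mul_tamagawaProduct_pos`,
  `…_div_norm_theta_eq_zero` (`0 < ρ`, `v_p ρ = 0` as named lemmas); **`missingPPartOverAt_theta_smul_iff`** — for the θ-scaling (`(C'.u)² = d_K`,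
  `|N θ| = |d_K|`, `abs_norm_eq_abs_of_sq_eq`) at a potentially multiplicative `p ∣ d_K`
  (`p ∥ d_K`, FILE U-1a `v_p C(W⊗K) = v_p ∏c_w + 1`):
  **`MissingPPartOverAt (C' • W_K) p ↔ MissingPPartOverCAt (W.baseChange K) p`**.
* §2 **The odd Tamagawa identity for the θ-model** on H-4b's population with `p ∣ d_K`
  (`padicValRat_norm_theta_mul_tamagawaProduct_eq_of_addv_unramified_oddPrime_of_dvd_discr`):
  `v_p(|N(C'.u)| · ∏_w c_w(C' • W_K)) = v_p(|C_d.u| · ∏c(W) · ∏c(W_d))` — FILE C-2's schema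
  `padicValRat_norm_mul_tamagawaProduct_eq_of_local_baseChange` with (T) at every place = H-5a
  `sum_fibre_…_of_unramifiedFact_oddPrime` fed with T-A233's THEOREM
  `kodairaSymbolAt_baseChange_of_ramificationIdx_eq_one_holds` (exactly as H-4b), and (P) at `p`:
  fibre `{𝔭}`, `f = 1`, `ord_𝔭 θ = 1 = ord_p(C_d.u)` (`sum_fibre_inertiaDeg_mul_ord_theta_eq_of_mult_twist`,
  C-3g `log_valuation_u_twist_eq_neg_one_of_potMult`). This is the hypothesis `hT` of J-2 for the
  θ-model; FILE U-2 feeds it in and descends with D-2 — the base-change-and-descend END in the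
  model-free currency, NO Milne, NO globally minimal `K`-model.

HONEST LIMITS: `d_K` odd squarefree, `p ∣ d_K` odd, `W_d` multiplicative at `p`, H-4b's population
(additive places of `W` prime to `d_K`, `p = 3 → ℓ ≠ 3`); TOOL theorems; closes no class; moves no
mark; 0 facts.

References: T. Dokchitser, V. Dokchitser, Ann. of Math. 172 (2010) §1 Notation, §2.1
[DokchitserDokchitserAnnals2010]; J. S. Milne, Invent. Math. 17 (1972) §1 Thm. 1
[Milne1972ArithmeticAV]; J. H. Silverman, *AEC* 2nd ed., VII.1 Prop. 1.3, VII.5 Prop. 5.4 (a)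
[SilvermanAEC2009]; J. Neukirch, *ANT*, Ch. I Prop. (8.2), Ch. III Prop. (1.2) [NeukirchANT1999].
-/

noncomputable section

open scoped Classical NumberField

open WeierstrassCurve NumberField IsDedekindDomain Rat.HeightOneSpectrum WithZero
  Literature.NumberTheory.EllipticCurves Literature.NumberTheory.EllipticCurves.Rank1Residual
  Literature.NumberTheory.EllipticCurves.Rank1Residual.Typed
  Literature.NumberTheory.DiophantineGeometry
  Literature.NumberTheory.DiophantineGeometry.UnramifiedBaseChange
  Summit.BirchSwinnertonDyer.Rank1Residual.Additive

namespace Summit.BirchSwinnertonDyer.Rank1Residual.AdditivePotMult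

/-! ## §1 The θ-model `C' • W_K`: Miller's input on it IS the model-free input on `W ⊗ K` -/

section ThetaModel

variable {K : Type} [Field K] [NumberField K]
  (W : WeierstrassCurve ℚ) [W.IsElliptic] [W.IsGloballyMinimal]
  (Wd : WeierstrassCurve ℚ) [Wd.IsElliptic] [Wd.IsGloballyMinimal]

omit [W.IsGloballyMinimal] in
/-- **`#Ш_an` of the θ-model against the model-free `#Ш_an` of the canonical model.** For ANY
`C' ∈ VariableChange K`, `shaAnOver (C' • W_K) = ρ · shaAnOverC (W ⊗ K)` with
`ρ = C(W⊗K) / (|N_{K/ℚ}(C'.u)| · ∏_w c_w(W_K))`: the leading coefficient, the torsion order, the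
regulator and the Tamagawa numbers are model invariants (tree `leadingLCoeff_smul`,
`torsionOrder_variableChange`, `regulator_variableChange`, `tamagawaProduct_variableChange_eq`), the
period scales by `|N(C'.u)|` (`bsdPeriod_smul'`). Pure bookkeeping; no hypothesis on `W`.
[cite: DokchitserDokchitserAnnals2010, §1 Notation and §2.1 (arXiv pp. 4–5)] -/
theorem shaAnOver_smul_baseChange_eq_mul_shaAnOverC (C' : VariableChange K) :
    shaAnOver (C' • W.baseChange K) =
      (((W.baseChange K).modifiedTamagawaProduct /
          (|Algebra.norm ℚ (C'.u : K)| * (W.baseChange K).tamagawaProduct) : ℚ) : ℂ) *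
        shaAnOverC (W.baseChange K) := by
  haveI : (W.baseChange K).IsElliptic := by rw [baseChange]; infer_instance
  set VK := W.baseChange K with hVK
  set N : ℚ := |Algebra.norm ℚ (C'.u : K)| with hN_def
  have hL : (C' • VK).leadingLCoeff = VK.leadingLCoeff := leadingLCoeff_smul VK C'
  have ht : (C' • VK).torsionOrder = VK.torsionOrder := torsionOrder_variableChange_holds VK C'
  have hR : (C' • VK).regulator = VK.regulator := regulator_variableChange_holds VK C'
  have hc : (C' • VK).tamagawaProduct = VK.tamagawaProduct := tamagawaProduct_variableChange_eq VK C'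
  have hΩ : (C' • VK).bsdPeriod = (N : ℝ) * VK.bsdPeriod := VK.bsdPeriod_smul' C'
  have hN0 : N ≠ 0 := abs_ne_zero.mpr (Algebra.norm_ne_zero_iff.mpr (C'.u).ne_zero)
  have hN : (N : ℂ) ≠ 0 := by exact_mod_cast hN0
  have hT : (VK.tamagawaProduct : ℂ) ≠ 0 := by exact_mod_cast VK.tamagawaProduct_pos'.ne'
  have hM : (VK.modifiedTamagawaProduct : ℂ) ≠ 0 := by
    exact_mod_cast (VK.modifiedTamagawaProduct_pos).ne'
  have hΩ' : ((C' • VK).bsdPeriod : ℂ) = (N : ℂ) * (VK.bsdPeriod : ℂ) := by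
    rw [hΩ]; push_cast; rfl
  rw [shaAnOver, shaAnOverC, hL, ht, hR, hc, hΩ']
  push_cast
  by_cases hΩ0 : (VK.bsdPeriod : ℂ) = 0
  · rw [hΩ0]; simp
  by_cases hR0 : (VK.regulator : ℂ) = 0
  · rw [hR0]; simp
  field_simp

omit [W.IsGloballyMinimal] in
/-- **`MissingPPartOverAt (C' • W_K) p ↔ MissingPPartOverCAt (W ⊗ K) p` as soon as
`v_p C(W⊗K) = v_p(|N(C'.u)| · ∏_w c_w(W_K))`**: the factor `ρ` of the previous theorem is a `p`-adic
unit and `#Ш` is a model invariant (`shaOrder_variableChange`). [cite: DokchitserDokchitserAnnals2010, §1 Notation and §2.1 (arXiv pp. 4–5)] -/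
theorem missingPPartOverAt_smul_iff_overC_of_padicValRat_eq (C' : VariableChange K) (p : ℕ)
    [hp : Fact p.Prime]
    (hρ : padicValRat p (W.baseChange K).modifiedTamagawaProduct =
      padicValRat p (|Algebra.norm ℚ (C'.u : K)| * (W.baseChange K).tamagawaProduct : ℚ)) :
    MissingPPartOverAt (C' • W.baseChange K) p ↔ MissingPPartOverCAt (W.baseChange K) p := by
  haveI : (W.baseChange K).IsElliptic := by rw [baseChange]; infer_instance
  set VK := W.baseChange K with hVK
  set ρ : ℚ := VK.modifiedTamagawaProduct / (|Algebra.norm ℚ (C'.u : K)| * VK.tamagawaProduct)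
    with hρ_def
  have hN : (|Algebra.norm ℚ (C'.u : K)| : ℚ) ≠ 0 :=
    abs_ne_zero.mpr (Algebra.norm_ne_zero_iff.mpr (C'.u).ne_zero)
  have hT : (VK.tamagawaProduct : ℚ) ≠ 0 := by exact_mod_cast VK.tamagawaProduct_pos'.ne'
  have hM : VK.modifiedTamagawaProduct ≠ 0 := (VK.modifiedTamagawaProduct_pos).ne'
  have hρ0 : ρ ≠ 0 := div_ne_zero hM (mul_ne_zero hN hT)
  have hρv : padicValRat p ρ = 0 := by
    rw [hρ_def, padicValRat.div hM (mul_ne_zero hN hT), hρ, sub_self]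
  have hsha : (C' • VK).shaOrder = VK.shaOrder := shaOrder_variableChange_holds VK C'
  have hmain : shaAnOver (C' • VK) = (ρ : ℂ) * shaAnOverC VK :=
    shaAnOver_smul_baseChange_eq_mul_shaAnOverC W C'
  constructor
  · rintro ⟨q, hq, hv⟩
    refine ⟨q / ρ, ?_, ?_⟩
    · rw [Rat.cast_div, eq_div_iff (by exact_mod_cast hρ0 : (ρ : ℂ) ≠ 0), mul_comm, ← hmain, hq]
    · by_cases hq0 : q = 0
      · subst hq0
        rw [zero_div, padicValRat.zero, ← hsha]
        rw [padicValRat.zero] at hv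
        exact hv
      rw [padicValRat.div hq0 hρ0, hρv, sub_zero, ← hsha]
      exact hv
  · rintro ⟨q, hq, hv⟩
    refine ⟨ρ * q, ?_, ?_⟩
    · rw [hmain, hq, Rat.cast_mul]
    · by_cases hq0 : q = 0
      · subst hq0
        rw [mul_zero, padicValRat.zero, hsha]
        rw [padicValRat.zero] at hv
        exact hv
      rw [padicValRat.mul hρ0 hq0, hρv, zero_add, hsha]
      exact hv

/-- **`v_p C(W ⊗ K) = v_p(|N_{K/ℚ}(C'.u)| · ∏_w c_w(W_K))` for the θ-scaling** (`(C'.u)² = d_K`):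
`W/ℚ` globally minimal, `K` quadratic with `d_K` squarefree, `p ∣ d_K` odd, `W_d = C_d • W^{(d_K)}`
globally minimal MULTIPLICATIVE at `p` — FILE U-1a's `v_p C(W⊗K) = v_p ∏c_w + 1` together with
`|N(C'.u)| = |d_K|` (`abs_norm_eq_abs_of_sq_eq`) and `v_p d_K = 1` (`p ∥ d_K`). Needs nothing about
the individual `c_w`. [cite: DokchitserDokchitserAnnals2010, §1 Notation and §2.1 (arXiv pp. 4–5)]
[cite: SilvermanAEC2009, VII.1 Prop. 1.3 (a)–(b)] -/
theorem padicValRat_modifiedTamagawaProduct_baseChange_eq_norm_theta_mul (h2 : Module.finrank ℚ K = 2)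
    (hdsq : Squarefree (NumberField.discr K)) (p : ℕ) [hp : Fact p.Prime] (hp2 : p ≠ 2)
    (hpd : (p : ℤ) ∣ NumberField.discr K)
    {Cd : VariableChange ℚ} (hWd : Cd • W.quadraticTwist (NumberField.discr K : ℚ) = Wd)
    (hmult : Mult Wd p) {C' : VariableChange K}
    (hθ : (C'.u : K) ^ 2 = algebraMap ℚ K (NumberField.discr K : ℚ)) :
    padicValRat p (W.baseChange K).modifiedTamagawaProduct =
      padicValRat p (|Algebra.norm ℚ (C'.u : K)| * (W.baseChange K).tamagawaProduct : ℚ) := by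
  haveI : (W.baseChange K).IsElliptic := by rw [baseChange]; infer_instance
  have hT : ((W.baseChange K).tamagawaProduct : ℚ) ≠ 0 := by
    exact_mod_cast (W.baseChange K).tamagawaProduct_pos'.ne'
  have hd0 : (NumberField.discr K : ℚ) ≠ 0 := by exact_mod_cast NumberField.discr_ne_zero K
  have hN : (|Algebra.norm ℚ (C'.u : K)| : ℚ) = |(NumberField.discr K : ℚ)| :=
    abs_norm_eq_abs_of_sq_eq h2 hθ
  -- `v_p |d_K| = 1` (`p ∥ d_K`, read at the place `v₀ ↔ p`)
  have hvd : padicValRat p |(NumberField.discr K : ℚ)| = 1 := by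
    set v₀ : HeightOneSpectrum (𝓞 ℚ) := (primesEquiv (R := 𝓞 ℚ)).symm ⟨p, hp.out⟩ with hv₀def
    have hv₀ : (primesEquiv v₀ : ℕ) = p := by rw [hv₀def, Equiv.apply_symm_apply]
    have hd1 : ((primesEquiv v₀ : ℕ) : ℤ) ∣ NumberField.discr K := by rw [hv₀]; exact hpd
    have hd2 : ¬ ((primesEquiv v₀ : ℕ) : ℤ) ^ 2 ∣ NumberField.discr K :=
      not_sq_dvd_of_squarefree hdsq _ (primesEquiv v₀).2
    have h := padicValRat_eq_neg_log_valuation v₀ hd0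
    rw [hv₀, valuation_ringOfIntegers_intCast_eq_exp_neg_one v₀ hd1 hd2, log_exp, neg_neg] at h
    rcases abs_choice (NumberField.discr K : ℚ) with h' | h' <;> rw [h']
    · exact h
    · rw [padicValRat.neg]; exact h
  rw [padicValRat_modifiedTamagawaProduct_baseChange_eq_succ_of_mult_twist W Wd h2 hdsq p hp2 hpd hWd
    hmult, padicValRat.mul (by rw [hN]; exact abs_ne_zero.mpr hd0) hT, hN, hvd, padicValRat.of_nat]
  ring

omit [W.IsGloballyMinimal] in
/-- The factor `ρ = C(W⊗K)/(|N_{K/ℚ}(C'.u)| · ∏_w c_w(W_K))` of `shaAnOver_smul_baseChange_eq_mul_shaAnOverC`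
is a POSITIVE rational (every term is: tree `modifiedTamagawaProduct_pos`, `tamagawaProduct_pos'`).
[folklore] -/
theorem modifiedTamagawaProduct_div_norm_mul_tamagawaProduct_pos (C' : VariableChange K) :
    0 < (W.baseChange K).modifiedTamagawaProduct /
      (|Algebra.norm ℚ (C'.u : K)| * (W.baseChange K).tamagawaProduct) := by
  haveI : (W.baseChange K).IsElliptic := by rw [baseChange]; infer_instance
  exact div_pos (W.baseChange K).modifiedTamagawaProduct_pos
    (mul_pos (abs_pos.mpr (Algebra.norm_ne_zero_iff.mpr (C'.u).ne_zero))
      (by exact_mod_cast (W.baseChange K).tamagawaProduct_pos'))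

/-- **`v_p ρ = 0` for the θ-scaling**: `ρ = C(W⊗K)/(|N θ| · ∏_w c_w(W_K))` is a `p`-adic unit when
`(C'.u)² = d_K`, `p ∥ d_K`, `W_d` multiplicative at `p` — `v_p ρ = (v_p ∏c_w + 1) − 1 − v_p ∏c_w = 0`
(previous valuation identity; needs nothing about the individual `c_w`).
[cite: DokchitserDokchitserAnnals2010, §1 Notation and §2.1 (arXiv pp. 4–5)] -/
theorem padicValRat_modifiedTamagawaProduct_div_norm_theta_eq_zero (h2 : Module.finrank ℚ K = 2)
    (hdsq : Squarefree (NumberField.discr K)) (p : ℕ) [hp : Fact p.Prime] (hp2 : p ≠ 2)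
    (hpd : (p : ℤ) ∣ NumberField.discr K)
    {Cd : VariableChange ℚ} (hWd : Cd • W.quadraticTwist (NumberField.discr K : ℚ) = Wd)
    (hmult : Mult Wd p) {C' : VariableChange K}
    (hθ : (C'.u : K) ^ 2 = algebraMap ℚ K (NumberField.discr K : ℚ)) :
    padicValRat p ((W.baseChange K).modifiedTamagawaProduct /
      (|Algebra.norm ℚ (C'.u : K)| * (W.baseChange K).tamagawaProduct)) = 0 := by
  haveI : (W.baseChange K).IsElliptic := by rw [baseChange]; infer_instance
  have hN : (|Algebra.norm ℚ (C'.u : K)| : ℚ) ≠ 0 :=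
    abs_ne_zero.mpr (Algebra.norm_ne_zero_iff.mpr (C'.u).ne_zero)
  have hT : ((W.baseChange K).tamagawaProduct : ℚ) ≠ 0 := by
    exact_mod_cast (W.baseChange K).tamagawaProduct_pos'.ne'
  have hM : (W.baseChange K).modifiedTamagawaProduct ≠ 0 :=
    ((W.baseChange K).modifiedTamagawaProduct_pos).ne'
  rw [padicValRat.div hM (mul_ne_zero hN hT),
    padicValRat_modifiedTamagawaProduct_baseChange_eq_norm_theta_mul W Wd h2 hdsq p hp2 hpd hWd hmult hθ,
    sub_self]

/-- **THE θ-MODEL BRIDGE.** `W/ℚ` globally minimal, `K` quadratic with `d_K` squarefree, `p ∣ d_K`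
odd, `W_d = C_d • W^{(d_K)}` globally minimal MULTIPLICATIVE at `p`, and `C' ∈ VariableChange K` whose
scaling squares to `d_K` (e.g. `⟨θ, 0, 0, 0⟩`, `θ² = d_K`): **`MissingPPartOverAt (C' • W_K) p ↔
MissingPPartOverCAt (W.baseChange K) p`** — `missingPPartOverAt_smul_iff_overC_of_padicValRat_eq` fed
with `padicValRat_modifiedTamagawaProduct_baseChange_eq_norm_theta_mul`.
[cite: DokchitserDokchitserAnnals2010, §1 Notation and §2.1 (arXiv pp. 4–5)]
[cite: SilvermanAEC2009, VII.1 Prop. 1.3 (a)–(b)] -/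
theorem missingPPartOverAt_theta_smul_iff (h2 : Module.finrank ℚ K = 2)
    (hdsq : Squarefree (NumberField.discr K)) (p : ℕ) [hp : Fact p.Prime] (hp2 : p ≠ 2)
    (hpd : (p : ℤ) ∣ NumberField.discr K)
    {Cd : VariableChange ℚ} (hWd : Cd • W.quadraticTwist (NumberField.discr K : ℚ) = Wd)
    (hmult : Mult Wd p) (C' : VariableChange K)
    (hθ : (C'.u : K) ^ 2 = algebraMap ℚ K (NumberField.discr K : ℚ)) :
    MissingPPartOverAt (C' • W.baseChange K) p ↔ MissingPPartOverCAt (W.baseChange K) p :=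
  missingPPartOverAt_smul_iff_overC_of_padicValRat_eq W C' p
    (padicValRat_modifiedTamagawaProduct_baseChange_eq_norm_theta_mul W Wd h2 hdsq p hp2 hpd hWd hmult hθ)

end ThetaModel

/-! ## §2 The odd Tamagawa identity for the θ-model -/

section ThetaTamagawa

variable (W : WeierstrassCurve ℚ) [W.IsElliptic] [W.IsGloballyMinimal]
  (K : Type) [Field K] [NumberField K]
  (Wd : WeierstrassCurve ℚ) [Wd.IsElliptic] [Wd.IsGloballyMinimal] (p : ℕ) [hp : Fact p.Prime]

/-- **(D) for the θ-scaling at the potentially multiplicative ramified prime**: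
`Σ_{w ∣ p} f(w|p)·ord_w(θ) = ord_p(C_d.u)` — both sides equal `1`: the fibre of `p ∣ d_K` is the single
ramified prime `𝔭` with `f = 1` and `ord_𝔭 θ = 1` (`θ² = d_K`, `p ∥ d_K`, `e = 2`), while
`ord_p(C_d.u) = 1` for the globally minimal multiplicative twist (C-3g
`log_valuation_u_twist_eq_neg_one_of_potMult`). [cite: SilvermanAEC2009, VII.1 Prop. 1.3 (a) and Table 3.1]
[cite: NeukirchANT1999, Ch. I, Prop. (8.2)] -/
theorem sum_fibre_inertiaDeg_mul_ord_theta_eq_of_mult_twist (h2 : Module.finrank ℚ K = 2)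
    (hdsq : Squarefree (NumberField.discr K)) (v₀ : HeightOneSpectrum (𝓞 ℚ))
    (hv₀ : (primesEquiv v₀ : ℕ) = p) (hp2 : p ≠ 2) (hpd : (p : ℤ) ∣ NumberField.discr K)
    {Cd : VariableChange ℚ} (hWd : Cd • W.quadraticTwist (NumberField.discr K : ℚ) = Wd)
    (hmult : Mult Wd p) {θ : K} (hθ : θ ^ 2 = algebraMap ℚ K (NumberField.discr K : ℚ)) :
    ∑ w ∈ (HeightOneSpectrum.finite_setOf_under_eq_of_numberField (K := K) v₀).toFinset,
        (w.asIdeal.inertiaDeg (𝓞 ℚ) : ℤ) * (-log (w.valuation K θ)) =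
      -log (v₀.valuation ℚ (Cd.u : ℚ)) := by
  have hv₀2 : (primesEquiv v₀ : ℕ) ≠ 2 := by rw [hv₀]; exact hp2
  have hd1 : ((primesEquiv v₀ : ℕ) : ℤ) ∣ NumberField.discr K := by rw [hv₀]; exact hpd
  have hd2 : ¬ ((primesEquiv v₀ : ℕ) : ℤ) ^ 2 ∣ NumberField.discr K :=
    not_sq_dvd_of_squarefree hdsq _ (primesEquiv v₀).2
  have hmultv : Wd.HasMultiplicativeReductionAt v₀ := by
    have hm : (haveI := Fact.mk (primesEquiv v₀).2
        Wd.HasMultiplicativeReductionAtPrime (primesEquiv v₀)) := by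
      have h : Wd.HasMultiplicativeReductionAtPrime p := hmult
      subst hv₀
      exact h
    exact (Wd.hasMultiplicativeReductionAtPrime_iff_hasMultiplicativeReductionAt_ringOfIntegers v₀).mp hm
  obtain ⟨𝔭, hset, he, hf⟩ : ∃ 𝔭 : HeightOneSpectrum (𝓞 K),
      {w' : HeightOneSpectrum (𝓞 K) | w'.under (𝓞 ℚ) = v₀} = {𝔭} ∧
        𝔭.asIdeal.ramificationIdx (𝓞 ℚ) = 2 ∧ 𝔭.asIdeal.inertiaDeg (𝓞 ℚ) = 1 := by
    rcases placesOver_trichotomy_of_finrank_eq_two K h2 v₀ with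
      ⟨w₁, w₂, hne, hset, -⟩ | ⟨w, hset, he, -⟩ | ⟨w, hset, he, hf⟩
    · exact absurd hd1 (not_dvd_and_isSquare_discr_of_split v₀ h2 hv₀2 hne hset).1
    · exact absurd hd1 (not_dvd_discr_of_fibre_eq_singleton K v₀ hset he)
    · exact ⟨w, hset, he, hf⟩
  have h𝔭v : 𝔭.under (𝓞 ℚ) = v₀ := under_eq_of_fibre_eq_singleton hset
  have h𝔭 : 𝔭.asIdeal.under (𝓞 ℚ) = v₀.asIdeal := by rw [← h𝔭v]; rfl
  have he' : v₀.asIdeal.ramificationIdx' 𝔭.asIdeal = 2 := by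
    rw [ramificationIdx'_eq_of_under_eq h𝔭v, he]
  -- `ord_𝔭 θ = 1`
  have hd0 : (NumberField.discr K : ℚ) ≠ 0 := by exact_mod_cast NumberField.discr_ne_zero K
  have hθ0 : θ ≠ 0 := by
    intro h
    rw [h, zero_pow two_ne_zero, eq_comm, map_eq_zero] at hθ
    exact hd0 hθ
  have hvθ : log (𝔭.valuation K θ) = -1 := by
    haveI : 𝔭.asIdeal.LiesOver v₀.asIdeal := ⟨h𝔭.symm⟩
    have hlies := IsDedekindDomain.HeightOneSpectrum.valuation_liesOver K v₀ 𝔭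
      (NumberField.discr K : ℚ)
    rw [valuation_ringOfIntegers_intCast_eq_exp_neg_one v₀ hd1 hd2, he', ← exp_nsmul, ← hθ,
      map_pow] at hlies
    have hu0 : 𝔭.valuation K θ ≠ 0 := (Valuation.ne_zero_iff _).mpr hθ0
    obtain ⟨m, hm⟩ : ∃ m : ℤ, 𝔭.valuation K θ = exp m := ⟨log _, (exp_log hu0).symm⟩
    rw [hm, ← exp_nsmul, exp_inj] at hlies
    rw [hm, log_exp]
    simp only [nsmul_eq_mul, Nat.cast_ofNat] at hlies
    omega
  rw [toFinset_eq_singleton_of_fibre hset, Finset.sum_singleton, hf, hvθ,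
    log_valuation_u_twist_eq_neg_one_of_potMult W Wd v₀ hv₀2 hd1 hd2 hWd hmultv]
  simp

/-- **THE ODD TAMAGAWA IDENTITY FOR THE θ-MODEL** on H-4b's population with `p ∣ d_K`. `W/ℚ`
globally minimal, `[K:ℚ] = 2` with `d_K` odd squarefree and `p ∣ d_K`, `p` odd, `W_d = C_d • W^{(d_K)}`
globally minimal MULTIPLICATIVE at `p`, `C' ∈ VariableChange K` with `(C'.u)² = d_K` (the θ-scaling),
and `hS`: at every place `W` is good ∨ multiplicative ∨ (`ℓ ∣ d_K` ∧ `W_d` multiplicative) ∨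
(additive, `ℓ ∤ d_K`, `p = 3 → ℓ ≠ 3`). THEN
`v_p(|N_{K/ℚ}(C'.u)| · ∏_w c_w(C' • W_K)) = v_p(|C_d.u| · ∏c(W) · ∏c(W_d))` — the hypothesis `hT` of
FILE J-2's `milneQuotient_ordp_of_tamagawa_anyRank` for the (non-minimal) θ-model. FILE C-2's schema
with (T) = H-5a + T-A233's `_holds` theorem and (P) = (T) + the previous lemma.
[cite: Milne1972ArithmeticAV, §1 Thm. 1 and §2 (through DokchitserDokchitserAnnals2010, §2.1, proof of Thm. 8)]
[cite: SilvermanAEC2009, Prop. VII.5.4 (a) and VII.1 Prop. 1.3] -/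
theorem padicValRat_norm_theta_mul_tamagawaProduct_eq_of_addv_unramified_oddPrime_of_dvd_discr
    (h2 : Module.finrank ℚ K = 2)
    (hdodd : Odd (NumberField.discr K)) (hdsq : Squarefree (NumberField.discr K))
    (hpd : (p : ℤ) ∣ NumberField.discr K)
    {Cd : VariableChange ℚ} (hWd : Cd • W.quadraticTwist (NumberField.discr K : ℚ) = Wd)
    (hp2 : p ≠ 2) (hmult : Mult Wd p)
    (hS : ∀ v : HeightOneSpectrum (𝓞 ℚ), W.HasGoodReductionAt v ∨ W.HasMultiplicativeReductionAt v ∨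
      (((primesEquiv v : ℕ) : ℤ) ∣ NumberField.discr K ∧ Wd.HasMultiplicativeReductionAt v) ∨
      (W.HasAdditiveReductionAt v ∧ ¬ ((primesEquiv v : ℕ) : ℤ) ∣ NumberField.discr K ∧
        (p = 3 → (primesEquiv v : ℕ) ≠ 3)))
    {C' : VariableChange K} (hθ : (C'.u : K) ^ 2 = algebraMap ℚ K (NumberField.discr K : ℚ)) :
    padicValRat p (|Algebra.norm ℚ (C'.u : K)| * (C' • W.baseChange K).tamagawaProduct : ℚ) =
      padicValRat p (|(Cd.u : ℚ)| * (W.tamagawaProduct * Wd.tamagawaProduct) : ℚ) := by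
  haveI : (W.baseChange K).IsElliptic := by rw [baseChange]; infer_instance
  set v₀ : HeightOneSpectrum (𝓞 ℚ) := (primesEquiv (R := 𝓞 ℚ)).symm ⟨p, hp.out⟩ with hv₀def
  have hv₀ : (primesEquiv v₀ : ℕ) = p := by rw [hv₀def, Equiv.apply_symm_apply]
  have hu' : (C'.u : K) ≠ 0 := Units.ne_zero _
  have hud : (Cd.u : ℚ) ≠ 0 := Units.ne_zero _
  have hT := fun v => sum_fibre_padicValNat_localTamagawaNumber_of_semistable_or_addv_of_unramifiedFact_oddPrime
    W K Wd h2 hdodd hdsq hWd p hp2 v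
    (fun w => UnramifiedBaseChange.kodairaSymbolAt_baseChange_of_ramificationIdx_eq_one_holds K v w W) (hS v)
  have hD := sum_fibre_inertiaDeg_mul_ord_theta_eq_of_mult_twist W K Wd p h2 hdsq v₀ hv₀ hp2 hpd hWd
    hmult hθ
  refine padicValRat_norm_mul_tamagawaProduct_eq_of_local_baseChange W Wd (C' • W.baseChange K) rfl
    hu' hud p v₀ hv₀ (fun v _ => hT v) ?_
  rw [Finset.sum_add_distrib, hD, ← Nat.cast_sum, hT v₀, Nat.cast_add]

end ThetaTamagawa

end Summit.BirchSwinnertonDyer.Rank1Residual.AdditivePotMult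

end
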